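import Summits.Ventures.PercRepro.C041TriDomExcessFour

/-!
# ROW C-041 — THE TWO-MARK DOMINATION: on every increasing family of colourings, blue connections are outnumbered by
red ones (p6, gen 43; P6-TWOEXIT-LEAN.md §53 ADDENDUM 10 cont. 2)

For two vertices `x, z` of a host and every UP-SET `V` of colourings (`UpSet`: closed under turning blue edges red),
   `#{ω ∈ V : x ~_B z} ≤ #{ω ∈ V : x ~_R z}`
(`cntB_le_cntR`, for every status `st`; `count_blue_le_count_red` for the all-free host; `forced_blue_le_red` for the
principal up-set `↑S` = the colourings with the set `S` red).  PROOF: a deletion–contraction induction on the number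
of free edges (the framework of `C041TriDomExcessRec`).  At a free edge `f` the up-set `V` splits into the up-sets
`V_R = {ω : V (ω[f := red])} ⊇ V_B = {ω : V (ω[f := blue])}`, the two counts satisfy
   `2·cntB st V = cntB (st[f := absent]) V_R + cntB (st[f := double]) V_B`,
   `2·cntR st V = cntR (st[f := double]) V_R + cntR (st[f := absent]) V_B`
(`cntB_rec`, `cntR_rec`: a red `f` is a double edge for the red connectivity and an absent one for the blue, a blue `f`
the other way round — `RAdjS_of_true` … `BAdjS_of_false` of `C041TriDomExcessFour`; the flip of `f` pairs the two colours), the induction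
hypothesis bounds both blue terms, and the remaining difference `Σ_ω ([V_R ω] − [V_B ω])·([x ~_R z]_{double} − [x ~_R
z]_{absent})` is non-negative pointwise (`ind_ineq`).  In this two-mark form the oriented three-mark domination
CONJECTURE of ADDENDUM 10 is a theorem; the three-mark statement is open (the forced-blue branch leaves the class).
-/

namespace PercRepro

namespace ZoneZ

namespace MultiExit

open ZoneData Finset

variable {V₁ E₁ U₁ U₂ : Type} (Z₁ : ZoneData V₁ E₁ U₁ U₂) (x z : V₁)

/-! ## Up-sets of colourings -/

/-- `ω ≤ ω'`: every red edge of `ω` is red in `ω'`. -/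
def LeCol (ω ω' : E₁ → Bool) : Prop := ∀ e, ω e = true → ω' e = true

/-- An UP-SET of colourings: closed under turning blue edges red. -/
def UpSet (V : (E₁ → Bool) → Prop) : Prop := ∀ ω ω', V ω → LeCol ω ω' → V ω'

variable [DecidableEq E₁]

/-- The up-set of the colourings whose update at `f` to `b` lies in `V`. -/
def sliceV (V : (E₁ → Bool) → Prop) (f : E₁) (b : Bool) : (E₁ → Bool) → Prop :=
  fun ω => V (Function.update ω f b)

/-- A slice of an up-set is an up-set. -/
theorem upSet_sliceV {V : (E₁ → Bool) → Prop} (hV : UpSet V) (f : E₁) (b : Bool) : UpSet (sliceV V f b) := by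
  intro ω ω' hω hle
  refine hV _ _ hω fun e he => ?_
  by_cases hef : e = f
  · subst hef; simpa using he
  · rw [Function.update_of_ne hef] at he ⊢
    exact hle e he

/-- The blue slice lies in the red slice. -/
theorem sliceV_false_le {V : (E₁ → Bool) → Prop} (hV : UpSet V) (f : E₁) (ω : E₁ → Bool)
    (h : sliceV V f false ω) : sliceV V f true ω := by
  refine hV _ _ h fun e he => ?_
  by_cases hef : e = f
  · subst hef; simp at he
  · rw [Function.update_of_ne hef] at he ⊢; exact he

/-- The slice at the colour of `f` is the family itself. -/
theorem sliceV_self (V : (E₁ → Bool) → Prop) (f : E₁) (ω : E₁ → Bool) : sliceV V f (ω f) ω ↔ V ω := by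
  unfold sliceV
  rw [Function.update_eq_self]

/-- The slice at the flipped colour of `f` evaluates `V` at the flip. -/
theorem sliceV_flip (V : (E₁ → Bool) → Prop) (f : E₁) (ω : E₁ → Bool) :
    sliceV V f (!ω f) ω ↔ V (flipC f ω) := Iff.rfl

/-! ## One edge, two colours (the adjacency lemmas `RAdjS_of_true` … `BAdjS_update_nonfree` of `C041TriDomExcessFour`) -/

/-- Red connectivity under the deletion implies it under the contraction. -/
theorem RdS_absent_le_double (st : E₁ → EStat) (f : E₁) (ω : E₁ → Bool)
    (h : RdS Z₁ (Function.update st f .absent) ω x z) : RdS Z₁ (Function.update st f .double) ω x z := by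
  refine reach_mono (fun a b hab => ?_) h
  obtain ⟨e, he, hr⟩ := hab
  refine ⟨e, he, ?_⟩
  by_cases hef : e = f
  · subst hef; simp [redE] at hr
  · simpa [redE, Function.update_of_ne hef] using hr

/-! ## The two counts and their recursions -/

variable [Fintype E₁]

open Classical in
/-- The number of colourings in `V` with `x` blue-connected to `z`. -/
noncomputable def cntB (st : E₁ → EStat) (V : (E₁ → Bool) → Prop) : ℤ :=
  ∑ ω : E₁ → Bool, if V ω ∧ MgS Z₁ st ω x z then 1 else 0

open Classical in
/-- The number of colourings in `V` with `x` red-connected to `z`. -/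
noncomputable def cntR (st : E₁ → EStat) (V : (E₁ → Bool) → Prop) : ℤ :=
  ∑ ω : E₁ → Bool, if V ω ∧ RdS Z₁ st ω x z then 1 else 0

open Classical in
/-- Twice an indicator sum is the sum of the indicator at `ω` and at the flip of `f`. -/
theorem two_mul_sum_eq_flip (f : E₁) (g : (E₁ → Bool) → ℤ) :
    2 * ∑ ω : E₁ → Bool, g ω = ∑ ω : E₁ → Bool, (g ω + g (flipC f ω)) := by
  have hflip : ∑ ω : E₁ → Bool, g ω = ∑ ω : E₁ → Bool, g (flipC f ω) :=
    (Equiv.sum_comp (flipPerm f) g).symm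
  rw [Finset.sum_add_distrib, ← hflip]; ring

omit [Fintype E₁] in
open Classical in
/-- The blue summand at `ω` and at the flip of a free edge `f`: the absent status on the red slice plus the double
status on the blue slice. -/
theorem blue_summand_add_flip (st : E₁ → EStat) (f : E₁) (hf : st f = .free) (V : (E₁ → Bool) → Prop)
    (ω : E₁ → Bool) :
    ((if V ω ∧ MgS Z₁ st ω x z then 1 else 0) + (if V (flipC f ω) ∧ MgS Z₁ st (flipC f ω) x z then 1 else 0) : ℤ) =
      (if sliceV V f true ω ∧ MgS Z₁ (Function.update st f .absent) ω x z then 1 else 0)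
        + (if sliceV V f false ω ∧ MgS Z₁ (Function.update st f .double) ω x z then 1 else 0) := by
  have hd : EStat.double ≠ EStat.free := by decide
  have ha : EStat.absent ≠ EStat.free := by decide
  have h1 : MgS Z₁ st ω x z ↔ MgS Z₁ (Function.update st f (if ω f then .absent else .double)) ω x z := by
    unfold MgS
    cases hω : ω f
    · rw [BAdjS_of_false Z₁ hf hω]; simp
    · rw [BAdjS_of_true Z₁ hf hω]; simp
  have h2 : MgS Z₁ st (flipC f ω) x z ↔
      MgS Z₁ (Function.update st f (if ω f then .double else .absent)) ω x z := by
    unfold MgS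
    cases hω : ω f
    · have hω' : flipC f ω f = true := by simp [flipC_apply_self, hω]
      rw [BAdjS_of_true Z₁ hf hω']
      unfold flipC
      rw [BAdjS_update_nonfree Z₁ st f ha]; simp
    · have hω' : flipC f ω f = false := by simp [flipC_apply_self, hω]
      rw [BAdjS_of_false Z₁ hf hω']
      unfold flipC
      rw [BAdjS_update_nonfree Z₁ st f hd]; simp
  have h3 : V ω ↔ sliceV V f (ω f) ω := (sliceV_self V f ω).symm
  have h4 : V (flipC f ω) ↔ sliceV V f (!ω f) ω := Iff.rfl
  rw [h1, h2, h3, h4]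
  cases ω f <;> simp [add_comm]

omit [Fintype E₁] in
open Classical in
/-- The red summand at `ω` and at the flip of a free edge `f`: the double status on the red slice plus the absent
status on the blue slice. -/
theorem red_summand_add_flip (st : E₁ → EStat) (f : E₁) (hf : st f = .free) (V : (E₁ → Bool) → Prop)
    (ω : E₁ → Bool) :
    ((if V ω ∧ RdS Z₁ st ω x z then 1 else 0) + (if V (flipC f ω) ∧ RdS Z₁ st (flipC f ω) x z then 1 else 0) : ℤ) =
      (if sliceV V f true ω ∧ RdS Z₁ (Function.update st f .double) ω x z then 1 else 0)
        + (if sliceV V f false ω ∧ RdS Z₁ (Function.update st f .absent) ω x z then 1 else 0) := by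
  have hd : EStat.double ≠ EStat.free := by decide
  have ha : EStat.absent ≠ EStat.free := by decide
  have h1 : RdS Z₁ st ω x z ↔ RdS Z₁ (Function.update st f (if ω f then .double else .absent)) ω x z := by
    unfold RdS
    cases hω : ω f
    · rw [RAdjS_of_false Z₁ hf hω]; simp
    · rw [RAdjS_of_true Z₁ hf hω]; simp
  have h2 : RdS Z₁ st (flipC f ω) x z ↔
      RdS Z₁ (Function.update st f (if ω f then .absent else .double)) ω x z := by
    unfold RdS
    cases hω : ω f
    · have hω' : flipC f ω f = true := by simp [flipC_apply_self, hω]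
      rw [RAdjS_of_true Z₁ hf hω']
      unfold flipC
      rw [RAdjS_update_nonfree Z₁ st f hd]; simp
    · have hω' : flipC f ω f = false := by simp [flipC_apply_self, hω]
      rw [RAdjS_of_false Z₁ hf hω']
      unfold flipC
      rw [RAdjS_update_nonfree Z₁ st f ha]; simp
  have h3 : V ω ↔ sliceV V f (ω f) ω := (sliceV_self V f ω).symm
  have h4 : V (flipC f ω) ↔ sliceV V f (!ω f) ω := Iff.rfl
  rw [h1, h2, h3, h4]
  cases ω f <;> simp [add_comm]

open Classical in
/-- **THE BLUE RECURSION** at a free edge. -/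
theorem cntB_rec (st : E₁ → EStat) (f : E₁) (hf : st f = .free) (V : (E₁ → Bool) → Prop) :
    2 * cntB Z₁ x z st V =
      cntB Z₁ x z (Function.update st f .absent) (sliceV V f true)
        + cntB Z₁ x z (Function.update st f .double) (sliceV V f false) := by
  unfold cntB
  rw [two_mul_sum_eq_flip, ← Finset.sum_add_distrib]
  exact Finset.sum_congr rfl fun ω _ => blue_summand_add_flip Z₁ x z st f hf V ω

open Classical in
/-- **THE RED RECURSION** at a free edge. -/
theorem cntR_rec (st : E₁ → EStat) (f : E₁) (hf : st f = .free) (V : (E₁ → Bool) → Prop) :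
    2 * cntR Z₁ x z st V =
      cntR Z₁ x z (Function.update st f .double) (sliceV V f true)
        + cntR Z₁ x z (Function.update st f .absent) (sliceV V f false) := by
  unfold cntR
  rw [two_mul_sum_eq_flip, ← Finset.sum_add_distrib]
  exact Finset.sum_congr rfl fun ω _ => red_summand_add_flip Z₁ x z st f hf V ω

/-- The pointwise inequality of the induction step. -/
theorem ind_ineq (a b c d : Prop) [Decidable a] [Decidable b] [Decidable c] [Decidable d] (hba : b → a)
    (hcd : c → d) :
    ((if a ∧ c then 1 else 0) + (if b ∧ d then 1 else 0) : ℤ) ≤ (if a ∧ d then 1 else 0) + (if b ∧ c then 1 else 0) := by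
  by_cases ha : a <;> by_cases hb : b <;> by_cases hc : c <;> by_cases hd : d <;> simp_all

open Classical in
/-- The red counts of the deletion and the contraction: the blue slice loses no more than the red slice. -/
theorem cntR_slices_le (st : E₁ → EStat) (f : E₁) {V : (E₁ → Bool) → Prop} (hV : UpSet V) :
    cntR Z₁ x z (Function.update st f .absent) (sliceV V f true)
        + cntR Z₁ x z (Function.update st f .double) (sliceV V f false) ≤
      cntR Z₁ x z (Function.update st f .double) (sliceV V f true)
        + cntR Z₁ x z (Function.update st f .absent) (sliceV V f false) := by
  unfold cntR
  rw [← Finset.sum_add_distrib, ← Finset.sum_add_distrib]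
  refine Finset.sum_le_sum fun ω _ => ?_
  exact ind_ineq _ _ _ _ (sliceV_false_le hV f ω) (RdS_absent_le_double Z₁ x z st f ω)

omit [DecidableEq E₁] [Fintype E₁] in
/-- Without free edges the two connectivities coincide. -/
theorem MgS_eq_RdS_of_nofree (st : E₁ → EStat) (hst : ∀ e, st e ≠ .free) (ω : E₁ → Bool) :
    MgS Z₁ st ω x z ↔ RdS Z₁ st ω x z := by
  unfold MgS RdS
  have h : BAdjS Z₁ st ω = RAdjS Z₁ st ω := by
    funext a b
    refine propext (exists_congr fun e => and_congr_right fun _ => ?_)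
    simp [redE, blueE, hst e]
  rw [h]

open Classical in
/-- **THEOREM (TWO-MARK DOMINATION), status form**: on every up-set of colourings, the blue-connected colourings are
outnumbered by the red-connected ones (induction on the number of free edges). -/
theorem cntB_le_cntR (st : E₁ → EStat) {V : (E₁ → Bool) → Prop} (hV : UpSet V) :
    cntB Z₁ x z st V ≤ cntR Z₁ x z st V := by
  suffices h : ∀ n : ℕ, ∀ st : E₁ → EStat, nfree st = n → ∀ V : (E₁ → Bool) → Prop, UpSet V →
      cntB Z₁ x z st V ≤ cntR Z₁ x z st V from h _ st rfl V hV
  intro n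
  induction n with
  | zero =>
    intro st hst V _
    have hno : ∀ e, st e ≠ .free := by
      intro e he
      have : e ∈ (univ.filter fun e => st e = .free) := by simp [he]
      rw [Finset.card_eq_zero.mp hst] at this
      exact absurd this (Finset.notMem_empty e)
    unfold cntB cntR
    refine le_of_eq (Finset.sum_congr rfl fun ω _ => ?_)
    rw [MgS_eq_RdS_of_nofree Z₁ x z st hno ω]
  | succ n ih =>
    intro st hst V hV
    have hne : (univ.filter fun e => st e = .free).Nonempty := by
      rw [← Finset.card_pos]; unfold nfree at hst; omega
    obtain ⟨f, hf⟩ := hne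
    have hf' : st f = .free := (Finset.mem_filter.mp hf).2
    have ha := ih (Function.update st f .absent) (by
      have := nfree_update hf' (s := .absent) (by decide); omega) (sliceV V f true) (upSet_sliceV hV f true)
    have hd := ih (Function.update st f .double) (by
      have := nfree_update hf' (s := .double) (by decide); omega) (sliceV V f false) (upSet_sliceV hV f false)
    have hB := cntB_rec Z₁ x z st f hf' V
    have hR := cntR_rec Z₁ x z st f hf' V
    have hS := cntR_slices_le Z₁ x z st f hV
    linarith

/-! ## The all-free host and the forced sets -/

open Classical in
/-- **THEOREM (TWO-MARK DOMINATION)**: for every up-set `V` of colourings of a finite host,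
`#{ω ∈ V : x ~_B z} ≤ #{ω ∈ V : x ~_R z}`. -/
theorem count_blue_le_count_red {V : (E₁ → Bool) → Prop} (hV : UpSet V) :
    (univ.filter fun ω : E₁ → Bool => V ω ∧ Z₁.Mg x z ω).card ≤
      (univ.filter fun ω : E₁ → Bool => V ω ∧ Z₁.Rd x z ω).card := by
  have h := cntB_le_cntR Z₁ x z (fun _ => EStat.free) hV
  unfold cntB cntR at h
  simp only [MgS_free, RdS_free] at h
  rw [Finset.card_filter, Finset.card_filter]
  exact_mod_cast h

omit [DecidableEq E₁] [Fintype E₁] in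
/-- The colourings with the set `S` red form an up-set. -/
theorem upSet_forced (S : Finset E₁) : UpSet fun ω : E₁ → Bool => ∀ e ∈ S, ω e = true := by
  intro ω ω' hω hle e he
  exact hle e (hω e he)

open Classical in
/-- **THE FORCED-SET FORM**: with the edges of `S` forced red, blue connections are outnumbered by red ones
(`P_p(x ~_B z) ≤ P_p(x ~_R z)` at every `p ≥ ½`, by the mixture of ADDENDUM 6). -/
theorem forced_blue_le_red (S : Finset E₁) :
    (univ.filter fun ω : E₁ → Bool => (∀ e ∈ S, ω e = true) ∧ Z₁.Mg x z ω).card ≤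
      (univ.filter fun ω : E₁ → Bool => (∀ e ∈ S, ω e = true) ∧ Z₁.Rd x z ω).card := by
  convert count_blue_le_count_red Z₁ x z (upSet_forced S) using 3

end MultiExit

end ZoneZ

end PercRepro
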